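import Mathlib
import HarnessLib

/-!
# Crux `DigitPolyUniformity` (stmt-QuantumAdvantage-1392), line `Sketch` (LAR composition, cycle 5:
# Matomäki–Radziwiłł–Tao classes): regrouping a weighted sum over aligned dyadic blocks

Stub `stub_regroup_blocks` (c5/S4) of line Sketch/LAR of crux stmt-QuantumAdvantage-1392
(`Summit.QuantumAdvantage.QuantumAdvantage.Theses.MobiusLadder.DigitPolyUniformity`). A phase that depends
only on the binary digits of `N` above position `h` is a `1`-bounded weight `w (⌊N / 2^h⌋)`, constant on
each aligned dyadic block `[2^h y, 2^h (y + 1))`. Writing `N = 2^h y + x` with `y < 2^m`, `x < 2^h`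
(`RegroupBlocks.sum_range_mul_blocks`, so that `⌊N / 2^h⌋ = y`, `RegroupBlocks.mul_add_div_of_lt`) gives

  `Σ_{N < 2^{h+m}} f(N) w(⌊N/2^h⌋) = Σ_{y < 2^m} (Σ_{x < 2^h} f(2^h y + x)) · w(y)`,

and the triangle inequality (`norm_sum_le`) with `‖w y‖ ≤ 1` yields

  `‖Σ_{N < 2^{h+m}} f(N) w(⌊N/2^h⌋)‖ ≤ Σ_{y < 2^m} ‖Σ_{x < 2^h} f(2^h y + x)‖`.

Mathlib only; no named facts.
-/

noncomputable section

namespace Summit.QuantumAdvantage.DigitPolyUniformity.SketchLAR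

open Finset

namespace RegroupBlocks

/-- **Splitting a sum over `range (m * n)` into `n` consecutive blocks of length `m`.**
`Σ_{c < m n} g(c) = Σ_{y < n} Σ_{r < m} g(m y + r)` (induction on `n`, peeling the last block with
`Finset.sum_range_add`). [folklore] -/
theorem sum_range_mul_blocks {M : Type*} [AddCommMonoid M] (g : ℕ → M) (m n : ℕ) :
    ∑ c ∈ range (m * n), g c = ∑ y ∈ range n, ∑ r ∈ range m, g (m * y + r) := by
  induction n with
  | zero => simp
  | succ n ih => rw [Nat.mul_succ, Finset.sum_range_add, ih, Finset.sum_range_succ]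

/-- **The block index is the quotient.** Inside block `y`, i.e. for `r < m`, `(m y + r) / m = y`.
[folklore] -/
theorem mul_add_div_of_lt {m r : ℕ} (y : ℕ) (hr : r < m) : (m * y + r) / m = y := by
  rw [Nat.mul_add_div (lt_of_le_of_lt (Nat.zero_le r) hr), Nat.div_eq_of_lt hr, add_zero]

/-- **One block of the weighted sum.** On block `y` the weight `w (⌊N / 2^h⌋)` is the constant `w y`,
so `Σ_{x < 2^h} f(2^h y + x) w(⌊(2^h y + x)/2^h⌋) = (Σ_{x < 2^h} f(2^h y + x)) · w(y)`. [folklore] -/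
theorem sum_block_mul_weight (f w : ℕ → ℂ) (h y : ℕ) :
    ∑ x ∈ range (2 ^ h), f (2 ^ h * y + x) * w ((2 ^ h * y + x) / 2 ^ h) =
      (∑ x ∈ range (2 ^ h), f (2 ^ h * y + x)) * w y := by
  rw [Finset.sum_mul]
  refine Finset.sum_congr rfl fun x hx => ?_
  rw [mul_add_div_of_lt y (Finset.mem_range.mp hx)]

end RegroupBlocks

/-- **Regrouping over aligned blocks (stub c5/S4 of line Sketch/LAR).** For sequences `f, w : ℕ → ℂ`
with `w` `1`-bounded and all `h, m`,
`‖Σ_{N < 2^{h+m}} f(N) w(⌊N/2^h⌋)‖ ≤ Σ_{y < 2^m} ‖Σ_{x < 2^h} f(2^h y + x)‖`: write `N = 2^h y + x`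
(`y < 2^m`, `x < 2^h`), note `⌊N/2^h⌋ = y` on block `y`, and apply the triangle inequality over the
blocks together with `‖w y‖ ≤ 1`. [folklore] -/
theorem stub_regroup_blocks (f w : ℕ → ℂ) (hw : ∀ y, ‖w y‖ ≤ 1) (h m : ℕ) :
    ‖∑ N ∈ range (2 ^ (h + m)), f N * w (N / 2 ^ h)‖ ≤
      ∑ y ∈ range (2 ^ m), ‖∑ x ∈ range (2 ^ h), f (2 ^ h * y + x)‖ := by
  rw [pow_add, RegroupBlocks.sum_range_mul_blocks (fun N => f N * w (N / 2 ^ h)) (2 ^ h) (2 ^ m),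
    Finset.sum_congr rfl fun y _ => RegroupBlocks.sum_block_mul_weight f w h y]
  refine (norm_sum_le _ _).trans (Finset.sum_le_sum fun y _ => ?_)
  rw [norm_mul]
  exact mul_le_of_le_one_right (norm_nonneg _) (hw y)

end Summit.QuantumAdvantage.DigitPolyUniformity.SketchLAR

end
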